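import Summits.Ventures.YMGap.RobustBall.RobustStarWindow
import Summits.Ventures.YMGap.RobustBall.RobustStarReceivedSum
import Summits.Ventures.YMGap.RobustBall.RobustStarCertificate
import Summits.Ventures.YMGap.RobustBall.TorusClusteringYM3
import HarnessLib

/-!
# Venture YMGap, track ROBUST-BALL (Y2) — crux Y2-X2 for the FULL tier-1 ball, step 5b: THE ROBUST
# VERTEX-STAR DOOR ⇒ torus clustering on the whole tier-1 ball `ClusterDomainFR ε₀ ε₁ r`, uniformly in `L`

HONEST FRAMING. WHAT THIS IS: a venture file (cell `pub-ymgap`, track Y2 ROBUST-BALL, seat ds-2): the assembly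
of S1–S5a. For `SU(N)` (`N ≥ 1`) on `(ℤ/L)^d` (`d ≥ 2`, every `L ≥ 3`), a one-link Kantorovich–Rubinstein
modulus `OneLinkKRModulus N R K` on `R ≥ 2(d−1)|β|/N`, and a member `W` of the TIER-1 ball
`ClusterDomainFR ε₀ ε₁ r` (finite range `r`, oscillation load `≤ ε₀`, Lipschitz load `≤ ε₁` — ANY polymers, not
only plaquettes): with `c ≥ K e^{ε₀}(1 + 2√N ε₁)|β|/N` (robust per-incidence coefficient), `λ ≥ √N ε₁`
(off-column rows), `θ = (2d−2)c + λ < 1` (in-star rows), `doorPoly d c < 1` (below the pole) and the ROBUST STAR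
DOOR `ρ = R_G^{(d)}(c) + (λ + θ^K·4dλ)/(1 − θ) < 1` (any Neumann depth `K`), the member's torus measure CLUSTERS:
`ClustersWith W β A m` with `m = κ₁/((r ⊔ 1) + 2)`, `κ₁ = (1−ρ)²/(2(2ρ·2d+1))`, `A = 4(2√N)² e^{2κ₁}` — constants
depending on `(N, d, c, λ, θ, K, r)` only, i.e. UNIFORMLY in `L` and in the member: `TorusClusteringOnBall`,
`TorusClusteringOnBallUpTo` (the door is monotone in `|β|`) and, for `d = 3`, Y4's `ClusterDomainClustering`.
This replaces the single-link door `rhoFR N c_W ε₀ ε₁ < 1` of `TorusClustering` (Wilson threshold `2/9` for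
`SU(2)`, `d = 4`) by the star door (Wilson threshold `9/25`) ON THE SAME BALL. WHAT THIS IS NOT: no number (rows
are `TorusRowsSU2Star`); radii are door artefacts; strong-coupling lattice statements on finite tori — nothing
about the continuum limit or the Millennium problem.

## References
* R. L. Dobrushin, S. B. Shlosman (1985); H. Föllmer, LNM 1362 (1988) Ch. I.
* The tree: `TorusDoor` (the robust single-link matrix), `StarWindowBoundWeight` / `PlaquetteActionWindow` (ds-4,
  the plaquette-local case of the same crux), `RobustStar*` (this seat), `TorusClusteringYM3` (Y4 bridge).
-/

noncomputable section

open MeasureTheory ProbabilityTheory Function Finset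
open Literature.Probability.LatticeModels
open Literature.Probability.LatticeModels.DobrushinMetric
open Literature.MathematicalPhysics.QuantumLattice (fundamentalRep)
open Literature.MathematicalPhysics.QuantumFieldTheory hiding ZdEdge
open Literature.MathematicalPhysics.QuantumFieldTheory.Balaban1983to89.StrongCouplingTorusWindow
open Literature.MathematicalPhysics.QuantumFieldTheory.Balaban1983to89.StrongCouplingDobrushinWindow
  (OneLinkKRModulus)
open Summit.Ventures.YMGap.DSWindow
open Summit.Ventures.YMGap.StarKernel
open Summit.Ventures.YMGap.StarResolventDim (Delta gaugeR doorPoly Delta_pos_of_door gaugeR_lt_one_of_door)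
open Summit.Ventures.YMGap.StarLemmaGDim
open Summit.Ventures.YMGap.RobustStar

namespace Summit.Ventures.YMGap.RobustBall

variable {d L N : ℕ} [NeZero L]

/-! ### One member: the robust star window data and `ClustersWith` -/

/-- **THE ROBUST STAR DOOR FOR ONE MEMBER ⇒ `ClustersWith`.** See the module docstring for the constants; the
coefficient `c` is any upper bound of the robust per-incidence coefficient (so that one certificate at `β⋆` serves
every `|β| ≤ β⋆`). [folklore] -/
theorem clustersWith_of_robustStar (hd : 2 ≤ d) (hN : 1 ≤ N) (hL : 3 ≤ L) {β ε₀ ε₁ R K c lam θ ρ : ℝ} {r Kn : ℕ}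
    (hK : 0 ≤ K) (hR : |β| / N * (2 * ((d : ℝ) - 1)) ≤ R) (hmod : OneLinkKRModulus N R K) (hε₁ : 0 ≤ ε₁)
    (hc : K * Real.exp ε₀ * (1 + 2 * Real.sqrt N * ε₁) * (|β| / N) ≤ c) (hlam : Real.sqrt N * ε₁ ≤ lam)
    (hθ : θ = (2 * (d : ℝ) - 2) * c + lam) (hθ1 : θ < 1) (hcd : doorPoly d c < 1)
    (hρ : ρ = gaugeR d c + (lam + θ ^ Kn * (4 * d * lam)) / (1 - θ)) (hρ1 : ρ < 1)
    {W : Perturbation d L N} (hW : W ∈ ClusterDomainFR ε₀ ε₁ r) :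
    ClustersWith W β
      (4 * (2 * Real.sqrt N) ^ 2 * Real.exp (2 * ((1 - ρ) ^ 2 / (2 * (2 * ρ * (2 * d : ℕ) + 1)))))
      ((1 - ρ) ^ 2 / (2 * (2 * ρ * (2 * d : ℕ) + 1)) / ((max r 1 + 2 : ℕ) : ℝ)) := by
  classical
  obtain ⟨hr, w, hwa, hwℓ⟩ := exists_witness_of_mem_clusterDomainFR hW
  have hL1 : 1 < L := by omega
  have hd1 : 1 ≤ d := by omega
  have hc0 : 0 ≤ c := le_trans (by positivity) hc
  have hlam0 : 0 ≤ lam := le_trans (by positivity) hlam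
  have hΔ : 0 < Delta d c := Delta_pos_of_door hd hc0 hcd
  have hgR : 0 ≤ gaugeR d c ∧ gaugeR d c < 1 := gaugeR_lt_one_of_door hd hc0 hcd
  have hd2 : (2 : ℝ) ≤ d := by exact_mod_cast hd
  have hθ0 : 0 ≤ θ := by rw [hθ]; nlinarith
  have h1θ : 0 < 1 - θ := by linarith
  have hρ0 : 0 ≤ ρ := by
    rw [hρ]
    refine add_nonneg hgR.1 (div_nonneg (add_nonneg hlam0 ?_) h1θ.le)
    have : 0 ≤ θ ^ Kn := pow_nonneg hθ0 Kn
    positivity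
  -- the robust single-link matrix, extended to all links with the off-column array `E`
  set nbr : Edge d L → Finset (Edge d L) := fun e => (univ.erase e).filter fun y => torusNorm (e.1 - y.1) ≤ max r 1
    with hnbr
  set E : Edge d L → Edge d L → ℝ := fun x z => if z ∈ nbr x then Real.sqrt N * w.crossLip 0 x z else 0 with hEdef
  have hE0 : ∀ x z, 0 ≤ E x z := fun x z => by
    simp only [hEdef]; split_ifs
    · exact mul_nonneg (Real.sqrt_nonneg _) (crossLip_nonneg w 0 x z)
    · exact le_rfl
  have hKR := isKRContraction_perturbedTorusSpec_of_hasRange hd1 hN hL1 hK hR hmod w hr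
  have hcoef : ∀ x : Edge d L,
      K * Real.exp (w.oscLoad 0 x) * (1 + 2 * Real.sqrt N * w.selfLipLoad 0 x) * (|β| / N) ≤ c := by
    intro x
    refine le_trans ?_ hc
    have h1 : Real.exp (w.oscLoad 0 x) ≤ Real.exp ε₀ := Real.exp_le_exp.2 (hwa x)
    have h2 : w.selfLipLoad 0 x ≤ ε₁ := by linarith [hwℓ x, crossLipLoad_nonneg w 0 x]
    have h3 : 0 ≤ w.selfLipLoad 0 x := selfLipLoad_nonneg w 0 x
    gcongr
  have hKR' : IsKRContraction (perturbedTorusSpec W β) suFrobDist (fun e => univ.erase e) (Cst c E) := by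
    refine isKRContraction_univ_of_le hKR (fun a b => suFrobDist_nonneg a b) (Cst_nonneg hc0 hE0) fun x y hy => ?_
    have hEy : E x y = Real.sqrt N * w.crossLip 0 x y := by simp only [hEdef]; exact if_pos hy
    have ht : (0 : ℝ) ≤ tInfluence x y := Nat.cast_nonneg _
    simp only [Cst]
    rw [hEy]
    nlinarith [mul_nonneg (sub_nonneg.2 (hcoef x)) ht]
  have hlamrow : ∀ x, ∑ z ∈ univ.erase x, E x z ≤ lam := by
    intro x
    calc ∑ z ∈ univ.erase x, E x z ≤ ∑ z ∈ univ.erase x, Real.sqrt N * w.crossLip 0 x z :=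
          sum_le_sum fun z _ => by
            simp only [hEdef]; split_ifs
            · exact le_rfl
            · exact mul_nonneg (Real.sqrt_nonneg _) (crossLip_nonneg w 0 x z)
      _ = Real.sqrt N * w.crossLipLoad 0 x := by rw [← mul_sum]; rfl
      _ ≤ Real.sqrt N * ε₁ := by
          refine mul_le_mul_of_nonneg_left ?_ (Real.sqrt_nonneg _)
          linarith [hwℓ x, selfLipLoad_nonneg w 0 x]
      _ ≤ lam := hlam
  have hrow : ∀ (s : Site d L), ∀ x ∈ vertexStar s, ∑ z ∈ (vertexStar s).erase x, Cst c E x z ≤ θ := by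
    intro s x hx; rw [hθ]; exact sum_star_erase_Cst_le hL hc0 hE0 hlamrow hx
  -- (H1), (H2), support
  have hcontract := robust_star_window (W := W) (β := β) hd hL hc0 hΔ hE0 hθ0 hθ1 hrow hKR' Kn
  have hsum : ∀ (s : Site d L) (x : Edge d L), x ∈ vertexStar s → ∑ y, Krob c E θ Kn s y x ≤ ρ := by
    intro s x hx; rw [hρ]; exact sum_Krob_le hd hL hc0 hΔ hgR.2.le hE0 hlamrow hθ0 hθ1 (hrow s) hx
  have hKloc : ∀ (s : Site d L) (y x : Edge d L), Krob c E θ Kn s y x ≠ 0 →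
      ∀ w' ∈ linkEnds y, torusNorm (s - w') ≤ (max r 1 + 2 : ℕ) := by
    intro s y x hk w' hw'
    have hyw : torusNorm (y.1 - w') ≤ 1 := torusNorm_fst_sub_linkEnds_le_one hw'
    rcases mem_starBoundary_or_of_Krob_ne_zero hk with hyb | ⟨x', hx', hE'⟩
    · have := torusNorm_le_one_of_mem_starBoundary hyb hw'
      omega
    · have hyn : y ∈ nbr x' := by
        by_contra h
        exact hE' (by simp only [hEdef, if_neg h])
      have hxy : torusNorm (x'.1 - y.1) ≤ max r 1 := (mem_filter.1 hyn).2
      have hsx : torusNorm (s - x'.1) ≤ 1 := torusNorm_sub_fst_le_one_of_mem_vertexStar hx'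
      have t1 := torusNorm_sub_le s x'.1 y.1
      have t2 := torusNorm_sub_le s y.1 w'
      omega
  -- the covariance bound for the member's torus measure
  intro F G ΔF ΔG δF δG n hFm hGm hFdep hGdep hFb hGb hFlip hGlip hdist
  set κ : ℝ := (1 - ρ) ^ 2 / (2 * (2 * ρ * (2 * d : ℕ) + 1)) with hκ
  have hFobs : LinkObs suFrobDist F ΔF δF := ⟨hFm, hFb, hFdep, hFlip.nonneg, hFlip.le⟩
  have hGobs : LinkObs suFrobDist G ΔG δG := ⟨hGm, hGb, hGdep, hGlip.nonneg, hGlip.le⟩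
  have hL₀ : ∀ x ∈ ΔF, ∀ z ∈ ΔG, ∀ a ∈ linkEnds x, ∀ w' ∈ linkEnds z, n - 2 ≤ torusNorm (a - w') :=
    fun x hx z hz a ha w' hw' => le_torusNorm_linkEnds_sub (hdist x hx z hz) ha hw'
  have key := spec_star_abs_covariance_le (isSpecification_perturbedTorusSpec W β)
    (isGibbsMeasure_perturbedMeasure W β) (r := suFrobDist) (R := 2 * Real.sqrt N) (by positivity)
    (fun p q => suFrobDist_le p q) (fun s y x => Krob_nonneg hd hc0 hΔ hE0 hθ0 hθ1 Kn s y x)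
    (ρ₀ := max r 1 + 2) (by omega) hKloc hcontract hρ0 hρ1 hsum hFobs hGobs (n - 2) hL₀
  refine key.trans ?_
  have hκ0 : 0 ≤ κ := by rw [hκ]; have := hρ0; positivity
  have hδF : 0 ≤ ∑ x ∈ ΔF, δF x := Finset.sum_nonneg fun x _ => hFlip.nonneg x
  have hδG : 0 ≤ ∑ y ∈ ΔG, δG y := Finset.sum_nonneg fun y _ => hGlip.nonneg y
  -- depth `⌊(n−2)/ρ₀⌋ ≥ n/ρ₀ − 2`
  set ρ₀ : ℕ := max r 1 + 2 with hρ₀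
  have hρ₀2 : (2 : ℝ) ≤ ρ₀ := by
    have : 2 ≤ ρ₀ := by omega
    exact_mod_cast this
  have hρ₀pos : (0 : ℝ) < ρ₀ := by linarith
  have hq : (n : ℝ) / ρ₀ - 2 ≤ (((n - 2) / ρ₀ : ℕ) : ℝ) := by
    have hdm := Nat.div_add_mod (n - 2) ρ₀
    have hml := Nat.mod_lt (n - 2) (show 0 < ρ₀ by omega)
    have h1 : ((n - 2 : ℕ) : ℝ) < ρ₀ * (((n - 2) / ρ₀ : ℕ) : ℝ) + ρ₀ := by
      have : (n - 2 : ℕ) < ρ₀ * ((n - 2) / ρ₀) + ρ₀ := by omega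
      exact_mod_cast this
    have h2 : (n : ℝ) - 2 ≤ ((n - 2 : ℕ) : ℝ) := by
      rcases Nat.lt_or_ge n 2 with h | h
      · rw [Nat.sub_eq_zero_of_le h.le]
        have : (n : ℝ) < 2 := by exact_mod_cast h
        simp; linarith
      · rw [Nat.cast_sub h]; push_cast; exact le_rfl
    have h3 : (n : ℝ) ≤ ρ₀ * (((n - 2) / ρ₀ : ℕ) : ℝ) + 2 * ρ₀ := by linarith
    have h4 : (n : ℝ) / ρ₀ ≤ (((n - 2) / ρ₀ : ℕ) : ℝ) + 2 := by
      rw [div_le_iff₀ hρ₀pos]; linarith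
    linarith
  have hexp : Real.exp (-(κ * (((n - 2) / ρ₀ : ℕ) : ℝ))) ≤ Real.exp (2 * κ) * Real.exp (-(κ / ρ₀) * n) := by
    rw [← Real.exp_add]
    refine Real.exp_le_exp.2 ?_
    have : κ * ((n : ℝ) / ρ₀ - 2) ≤ κ * (((n - 2) / ρ₀ : ℕ) : ℝ) := mul_le_mul_of_nonneg_left hq hκ0
    have e : -(κ / ρ₀) * n = -(κ * ((n : ℝ) / ρ₀)) := by ring
    rw [e]; nlinarith
  calc 4 * (2 * Real.sqrt N) ^ 2 * Real.exp (-(κ * (((n - 2) / ρ₀ : ℕ) : ℝ))) * (∑ x ∈ ΔF, δF x) * ∑ y ∈ ΔG, δG y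
      ≤ 4 * (2 * Real.sqrt N) ^ 2 * (Real.exp (2 * κ) * Real.exp (-(κ / ρ₀) * n)) * (∑ x ∈ ΔF, δF x) *
          ∑ y ∈ ΔG, δG y := by gcongr
    _ = 4 * (2 * Real.sqrt N) ^ 2 * Real.exp (2 * κ) * (∑ y ∈ ΔG, δG y) * (∑ x ∈ ΔF, δF x) *
          Real.exp (-(κ / ρ₀) * n) := by ring

/-! ### The ball: torus clustering uniformly in `L`, up to `β⋆`, and Y4's receiving currency -/

/-- **TORUS CLUSTERING ON THE WHOLE TIER-1 BALL THROUGH THE ROBUST STAR DOOR**, uniformly in the torus side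
`L ≥ 3` (`TorusClusteringOnBall`). [folklore] -/
theorem torusClusteringOnBall_of_robustStar (hd : 2 ≤ d) (hN : 1 ≤ N) {β ε₀ ε₁ R K c lam θ ρ : ℝ}
    (r : ℕ) (Kn : ℕ) (hK : 0 ≤ K) (hR : |β| / N * (2 * ((d : ℝ) - 1)) ≤ R) (hmod : OneLinkKRModulus N R K)
    (hε₁ : 0 ≤ ε₁) (hc : K * Real.exp ε₀ * (1 + 2 * Real.sqrt N * ε₁) * (|β| / N) ≤ c)
    (hlam : Real.sqrt N * ε₁ ≤ lam) (hθ : θ = (2 * (d : ℝ) - 2) * c + lam) (hθ1 : θ < 1) (hcd : doorPoly d c < 1)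
    (hρ : ρ = gaugeR d c + (lam + θ ^ Kn * (4 * d * lam)) / (1 - θ)) (hρ1 : ρ < 1) :
    TorusClusteringOnBall N d β ε₀ ε₁ r
      (4 * (2 * Real.sqrt N) ^ 2 * Real.exp (2 * ((1 - ρ) ^ 2 / (2 * (2 * ρ * (2 * d : ℕ) + 1)))))
      ((1 - ρ) ^ 2 / (2 * (2 * ρ * (2 * d : ℕ) + 1)) / ((max r 1 + 2 : ℕ) : ℝ)) :=
  fun _L _ hL _W hW => clustersWith_of_robustStar hd hN hL hK hR hmod hε₁ hc hlam hθ hθ1 hcd hρ hρ1 hW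

/-- **… UP TO `β⋆`** (`TorusClusteringOnBallUpTo`, the form Y4 consumes): the door at `β⋆ ≥ 0` serves every
`0 ≤ β ≤ β⋆` with the SAME constants (the robust coefficient is monotone in `|β|`). [folklore] -/
theorem torusClusteringOnBallUpTo_of_robustStar (hd : 2 ≤ d) (hN : 1 ≤ N) {βs ε₀ ε₁ R K c lam θ ρ : ℝ}
    (r : ℕ) (Kn : ℕ) (hK : 0 ≤ K) (hR : βs / N * (2 * ((d : ℝ) - 1)) ≤ R)
    (hmod : OneLinkKRModulus N R K) (hε₁ : 0 ≤ ε₁) (hc : K * Real.exp ε₀ * (1 + 2 * Real.sqrt N * ε₁) * (βs / N) ≤ c)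
    (hlam : Real.sqrt N * ε₁ ≤ lam) (hθ : θ = (2 * (d : ℝ) - 2) * c + lam) (hθ1 : θ < 1) (hcd : doorPoly d c < 1)
    (hρ : ρ = gaugeR d c + (lam + θ ^ Kn * (4 * d * lam)) / (1 - θ)) (hρ1 : ρ < 1) :
    TorusClusteringOnBallUpTo N d βs ε₀ ε₁ r
      (4 * (2 * Real.sqrt N) ^ 2 * Real.exp (2 * ((1 - ρ) ^ 2 / (2 * (2 * ρ * (2 * d : ℕ) + 1)))))
      ((1 - ρ) ^ 2 / (2 * (2 * ρ * (2 * d : ℕ) + 1)) / ((max r 1 + 2 : ℕ) : ℝ)) := by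
  intro β hβ0 hββs
  have hβ : |β| ≤ βs := by rw [abs_of_nonneg hβ0]; exact hββs
  have hN0 : (0 : ℝ) ≤ N := Nat.cast_nonneg _
  have hd2 : (2 : ℝ) ≤ d := by exact_mod_cast hd
  have hR' : |β| / N * (2 * ((d : ℝ) - 1)) ≤ R := by
    refine le_trans ?_ hR
    have : |β| / N ≤ βs / N := div_le_div_of_nonneg_right hβ hN0
    nlinarith
  have hc' : K * Real.exp ε₀ * (1 + 2 * Real.sqrt N * ε₁) * (|β| / N) ≤ c := by
    refine le_trans ?_ hc
    have : |β| / N ≤ βs / N := div_le_div_of_nonneg_right hβ hN0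
    have hpos : 0 ≤ K * Real.exp ε₀ * (1 + 2 * Real.sqrt N * ε₁) := by positivity
    exact mul_le_mul_of_nonneg_left this hpos
  exact torusClusteringOnBall_of_robustStar hd hN r Kn hK hR' hmod hε₁ hc' hlam hθ hθ1 hcd hρ hρ1

/-- **Y4's receiving currency for `d = 3` through the robust star door**: `ClusterDomainClustering` on the
tier-1 ball `ClusterDomainFR ε₀ ε₁ r` up to `β⋆` at rate `κ₁/((r ⊔ 1)+2)`, `κ₁ = (1−ρ)²/(2(12ρ+1))`. [folklore] -/
theorem clusterDomainClustering_dim3_of_robustStar (hN : 1 ≤ N) {βs ε₀ ε₁ R K c lam θ ρ : ℝ}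
    (r : ℕ) (Kn : ℕ) (hK : 0 ≤ K) (hR : βs / N * 4 ≤ R)
    (hmod : OneLinkKRModulus N R K) (hε₁ : 0 ≤ ε₁) (hc : K * Real.exp ε₀ * (1 + 2 * Real.sqrt N * ε₁) * (βs / N) ≤ c)
    (hlam : Real.sqrt N * ε₁ ≤ lam) (hθ : θ = 4 * c + lam) (hθ1 : θ < 1) (hcd : doorPoly 3 c < 1)
    (hρ : ρ = gaugeR 3 c + (lam + θ ^ Kn * (12 * lam)) / (1 - θ)) (hρ1 : ρ < 1) :
    YM3IR.ClusterDomainClustering (G := SUN N)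
      ⟨fundamentalRep (Fin N), βs, fun _ _ W => W ∈ ClusterDomainFR ε₀ ε₁ r⟩ suFrobDist
      ((1 - ρ) ^ 2 / (2 * (2 * ρ * (2 * 3 : ℕ) + 1)) / ((max r 1 + 2 : ℕ) : ℝ)) := by
  have e4 : (2 : ℝ) * (((3 : ℕ) : ℝ) - 1) = 4 := by norm_num
  have e4' : (2 : ℝ) * ((3 : ℕ) : ℝ) - 2 = 4 := by norm_num
  have e12 : (4 : ℝ) * ((3 : ℕ) : ℝ) * lam = 12 * lam := by push_cast; ring
  have h := torusClusteringOnBallUpTo_of_robustStar (d := 3) (N := N) (by norm_num) hN r Kn hK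
    (βs := βs) (R := R) (by rw [e4]; exact hR) hmod hε₁ hc hlam (by rw [e4']; exact hθ) hθ1 hcd
    (by rw [e12]; exact hρ) hρ1
  exact clusterDomainClustering_of_torusClusteringOnBallUpTo h

end Summit.Ventures.YMGap.RobustBall

end
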